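import Literature.Geometry.Kaehler.ComplexTorusIntegralLefschetzFormsDiscriminant
import Literature.Geometry.Kaehler.ComplexTorusIntegralCoLefschetzMinimalClassCokernels
import HarnessLib

/-!
# The discriminant group `ℤ^m/G·ℤ^m` of a Lefschetz form `(x, y) ↦ ⟨x, L y⟩` on `Hᵏ(X, ℤ)` is the cokernel of `L : Hᵏ(X, ℤ) → H^{2g−k}(X, ℤ)`
# (Poincaré duality over `ℤ`); for the minimal classes: `ℤ^{2g}/B₁ℤ^{2g} ≅ ⊕ₐ (ℤ/(d_g/d_a))²`, `ℤ^m/B₂ℤ^m ≅ ℤ/(g−1)` (constant type)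

Layer `Literature/Geometry/Kaehler`, namespace `Literature.Geometry.Kaehler.ComplexTorus`; lane `lit-hodgefound` (Track 2
foundations library), seat p09, generation 42, row g42-#2 (successor-menu item (b) of generation 41). THEOREMS ONLY (0 definitions);
no named fact, net debt 0. Sequel of g41-#1 `ComplexTorusIntegralLefschetzFormsDiscriminant` (the Poincaré-dual basis and
`[Hˡ(X, ℤ) : L(Hᵏ(X, ℤ))] = |det (⟨b_i, L b_j⟩)|`) and of g40-#5/#6 (the cokernels of the minimal classes `γ_{g−1} ∧ (−)` on `H¹(X, ℤ)` and
`γ_{g−2} ∧ (−)` on `H²(X, ℤ)`).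

THE POINT. For a complex torus `X = E/Φ(ℤ^ι)` of dimension `g` (`k + l = n = 2g`), an additive `L : Hᵏ(X, ℂ) → Hˡ(X, ℂ)` with
`L(Hᵏ(X, ℤ)) ⊆ Hˡ(X, ℤ)` (e.g. cup product with an integral class) and a `ℤ`-basis `b = (b_i)_{i ∈ m}` of `Hᵏ(X, ℤ)`, the bilinear form
`B_L(x, y) = ⟨x, L y⟩` on `Hᵏ(X, ℤ)` has the integer Gram matrix `G = (⟨b_i, L b_j⟩)_{ij}` and the DISCRIMINANT GROUP (cokernel of the adjoint
`y ↦ B_L(·, y)`, in coordinates `ℤ^m/G·ℤ^m`, `G·ℤ^m` the column span). Poincaré duality over `ℤ` (Lange 2023, §6.2.4 p. 310: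
`Hᵏ(X, ℤ) ⊗ H^{2g−k}(X, ℤ) → H^{2g}(X, ℤ) ≃ ℤ` "yields the Poincaré duality `Hᵖ(X, ℤ) ⥲ H^{2g−p}(X, ℤ)^*`") identifies `Hˡ(X, ℤ)` with
`Hom(Hᵏ(X, ℤ), ℤ) ≅ ℤ^m` by `δ ↦ (⟨b_i, δ⟩)_i` (the coordinates in the Poincaré-dual basis `b^∨`, g41-#1), and under this identification
`L b_j ↦` the `j`-th column of `G`, `L(Hᵏ(X, ℤ)) ↦ G·ℤ^m`. Hence (§1, ANY complex torus, no polarisation):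

  **`ℤ^m / G·ℤ^m ≃+ Hˡ(X, ℤ) / L(Hᵏ(X, ℤ))`** — the discriminant group of `B_L` is the cokernel of `L`

(its order is `|det G| = [Hˡ(X, ℤ) : L(Hᵏ(X, ℤ))]`, g41-#1 `relIndex_map_integralForms_eq_natAbs_det`; Conway–Sloane Ch. 2 §2.4: "the dual
quotient group `Λ*/Λ`, which has order `det Λ`" and whose structure is given by the elementary divisors of the Gram matrix). For a polarised
torus of type `(d₁, …, d_g)` and the minimal classes `γ_q = θ^{∧q}/(q!·d₁⋯d_q)` (any presentation, any orientation, any `ℤ`-basis):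

* §2 **`ℤ^{2g}/G₁·ℤ^{2g} ≃+ ⊕_x ℤ/(d_g/d_{a(x)}) = ⊕_{a=1}^{g} (ℤ/(d_g/d_a))²`** for the `H¹` Lefschetz form `B₁(x, y) = ⟨x, γ_{g−1} ∧ y⟩`
  (g40-#5: the cokernel of `γ_{g−1} ∧ (−) : H¹(X, ℤ) → H^{2g−1}(X, ℤ)`) — the elementary divisors of `G₁` are the `d_g/d_a`, each twice
  (compare g41-#6 / g42-#1: `B₁` is symplectic of type `(1, d_g/d_{g−1}, …, d_g/d₁)`);
* §3 **`ℤ^m/G₂·ℤ^m ≃+ ℤ/(g−1)`** for the `H²` Lefschetz form `B₂(x, y) = ⟨x, γ_{g−2} ∧ y⟩` of a CONSTANT type (e.g. a principal polarisation),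
  `m = rk H²(X, ℤ) = g(2g−1)` (g40-#6: the cokernel of `γ_{g−2} ∧ (−)` on `H²(X, ℤ)` is cyclic of order `g − 1`, generated by `γ_{g−1}`).

Sources: Lange 2023 §6.2.4 (PDF p. 310 L9–L13; proof of Prop. 6.2.20: the dual bases `e_I`, `f_{I°}`), §1.1.2 proof of Prop. 1.1.13 (c)
(PDF p. 22: index `= |det|`), §5.4.1 Thm. 5.4.1 and (5.22) (PDF p. 275), §2.5.3 Cor. 2.5.17 (PDF p. 135), §1.5.1 (PDF p. 51), §4.2 (PDF p. 204);
Conway–Sloane 1999 Ch. 2 §2.4 (PDF p. 162: the dual quotient `Λ*/Λ`); Voisin 2002 §7.1.2 (PDF p. 134 L31), §7.2.2 (PDF p. 142 L10);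
Benoist–Debarre 2023 §1 (p. 3: minimal classes).

## Contents (theorems only)

* §1 `nonempty_addEquiv_quotient_range_mulVecLin_of_eq_poincarePairing` (the glue, any torus, any `L`), with the order
  `natCard_quotient_range_mulVecLin_eq_natAbs_det_of_eq_poincarePairing`.
* §2 `IsPolarizationType.nonempty_addEquiv_quotient_range_mulVecLin_pi_zmod_of_eq_content_smul` (+ existence form).
* §3 `IsPolarizationType.nonempty_addEquiv_quotient_range_mulVecLin_zmod_of_eq_content_smul_of_forall_eq` (+ existence form).

## References

* [cite: Lange2023AbelianVarietiesComplex, §6.2.4 (PDF p. 310 L9–L13) and proof of Prop. 6.2.20; §1.1.2 proof of Prop. 1.1.13 (c) (PDF p. 22); §5.4.1 Thm. 5.4.1, (5.22) (PDF p. 275); §2.5.3 Cor. 2.5.17 (PDF p. 135); §1.5.1 (PDF p. 51); §4.2 (PDF p. 204)]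
* [cite: ConwaySloane1999, Ch. 2 §2.4 (PDF p. 162)]
* [cite: VoisinHodgeI2002, §7.1.2 (PDF p. 134 L31); §7.2.2 (PDF p. 142 L10)]
* [cite: BenoistDebarre2023SmoothSubvarietiesJacobians, §1 (p. 3)]
-/

noncomputable section

open Module Function
open Literature.LinearAlgebra.Alternating

namespace Literature.Geometry.Kaehler.ComplexTorus

/-! ## §1 The discriminant group of `(x, y) ↦ ⟨x, L y⟩` is the cokernel of `L` -/

section Glue

variable {ι : Type*} [Fintype ι] [DecidableEq ι] {E : Type*} [NormedAddCommGroup E] [NormedSpace ℂ E]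
  (Φ : (ι → ℝ) ≃L[ℝ] E) {n k l : ℕ}

/-- **The discriminant group of a Lefschetz form is the cokernel of its operator** (any complex torus `X = E/Φ(ℤ^ι)`, `k + l = 2 dim X`): for an
additive `L : Hᵏ(X, ℂ) → Hˡ(X, ℂ)` with `L(Hᵏ(X, ℤ)) ⊆ Hˡ(X, ℤ)`, a `ℤ`-basis `b` of `Hᵏ(X, ℤ)` indexed by `m`, and the integer Gram matrix
`G = (⟨b_i, L b_j⟩)_{ij}` of the form `(x, y) ↦ ⟨x, L y⟩`,

  `ℤ^m / G·ℤ^m ≃+ Hˡ(X, ℤ) / L(Hᵏ(X, ℤ))`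

(`G·ℤ^m` the column span = the range of `G` acting on `ℤ^m`). Poincaré duality `Hˡ(X, ℤ) ⥲ Hom(Hᵏ(X, ℤ), ℤ) = ℤ^m`, `δ ↦ (⟨b_i, δ⟩)_i`, carries
`L b_j` to the `j`-th column of `G`. [cite: Lange2023AbelianVarietiesComplex, §6.2.4 (PDF p. 310 L9–L13) and proof of Prop. 6.2.20] [cite: ConwaySloane1999, Ch. 2 §2.4 (PDF p. 162)] -/
theorem nonempty_addEquiv_quotient_range_mulVecLin_of_eq_poincarePairing (e : Fin n ≃ ι) (h : k + l = n) {m : Type*} [Fintype m]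
    [DecidableEq m] (b : Basis m ℤ ↥(integralForms Φ k)) (L : (E [⋀^Fin k]→L[ℝ] ℂ) →+ (E [⋀^Fin l]→L[ℝ] ℂ))
    (hL : (integralForms Φ k).map L ≤ integralForms Φ l) (G : Matrix m m ℤ)
    (hG : ∀ i j, (G i j : ℂ) = poincarePairing Φ e h (b i : E [⋀^Fin k]→L[ℝ] ℂ) (L (b j))) :
    Nonempty (((m → ℤ) ⧸ LinearMap.range (Matrix.mulVecLin G)) ≃+
      (↥(integralForms Φ l) ⧸ ((integralForms Φ k).map L).addSubgroupOf (integralForms Φ l))) := by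
  classical
  obtain ⟨b₂, hb₂⟩ := exists_basis_repr_eq_poincarePairing Φ e h b
  -- `L` restricted to `Hᵏ(X, ℤ) → Hˡ(X, ℤ)`, `ℤ`-linear
  set L' : ↥(integralForms Φ k) →ₗ[ℤ] ↥(integralForms Φ l) :=
    ((L.comp (integralForms Φ k).subtype).codRestrict (integralForms Φ l) fun x ↦ hL ⟨x, x.2, rfl⟩).toIntLinearMap with hL'def
  have hL' : ∀ x, (L' x : E [⋀^Fin l]→L[ℝ] ℂ) = L x := fun x ↦ rfl
  -- coordinates in the Poincaré-dual basis: `δ ↦ (⟨b_i, δ⟩)_i`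
  set ψ : ↥(integralForms Φ l) ≃ₗ[ℤ] (m → ℤ) := b₂.repr.trans (Finsupp.linearEquivFunOnFinite ℤ ℤ m) with hψ
  have hψL : ∀ j, ψ (L' (b j)) = G.col j := fun j ↦ by
    funext i
    apply Int.cast_injective (α := ℂ)
    rw [hψ, LinearEquiv.trans_apply, Finsupp.linearEquivFunOnFinite_apply, hb₂, hL', Matrix.col_apply, hG]
  -- the image of `L(Hᵏ(X, ℤ))` is the column span of `G`
  have hmap : (LinearMap.range L').map (ψ : ↥(integralForms Φ l) →ₗ[ℤ] (m → ℤ)) = LinearMap.range (Matrix.mulVecLin G) := by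
    rw [Matrix.range_mulVecLin, LinearMap.range_eq_map, ← b.span_eq, Submodule.map_span, Submodule.map_span, ← Set.range_comp,
      ← Set.range_comp]
    refine congrArg (Submodule.span ℤ) (congrArg Set.range (funext fun j ↦ ?_))
    rw [comp_apply, comp_apply, LinearEquiv.coe_coe, hψL]
  have hS : ((integralForms Φ k).map L).addSubgroupOf (integralForms Φ l) = (LinearMap.range L').toAddSubgroup := by
    ext x
    simp only [AddSubgroup.mem_addSubgroupOf, AddSubgroup.mem_map, Submodule.mem_toAddSubgroup, LinearMap.mem_range]
    constructor
    · rintro ⟨y, hy, hyx⟩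
      exact ⟨⟨y, hy⟩, Subtype.ext (by rw [hL']; exact hyx)⟩
    · rintro ⟨y, rfl⟩
      exact ⟨y, y.2, (hL' y).symm⟩
  exact ⟨(Submodule.Quotient.equiv (LinearMap.range L') (LinearMap.range (Matrix.mulVecLin G)) ψ hmap).toAddEquiv.symm.trans
    (QuotientAddGroup.quotientAddEquivOfEq hS).symm⟩

/-- **The order of the discriminant group is `|det G|`** (`L` injective on `Hᵏ(X, ℤ)`): `|ℤ^m/G·ℤ^m| = |det (⟨b_i, L b_j⟩)| = [Hˡ(X, ℤ) : L(Hᵏ(X, ℤ))]`.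
[cite: Lange2023AbelianVarietiesComplex, §6.2.4 (PDF p. 310); §1.1.2 proof of Prop. 1.1.13 (c) (PDF p. 22)] [cite: ConwaySloane1999, Ch. 2 §2.4 (PDF p. 162)] -/
theorem natCard_quotient_range_mulVecLin_eq_natAbs_det_of_eq_poincarePairing (e : Fin n ≃ ι) (h : k + l = n) {m : Type*} [Fintype m]
    [DecidableEq m] (b : Basis m ℤ ↥(integralForms Φ k)) (L : (E [⋀^Fin k]→L[ℝ] ℂ) →+ (E [⋀^Fin l]→L[ℝ] ℂ))
    (hL : (integralForms Φ k).map L ≤ integralForms Φ l) (hinj : ∀ x ∈ integralForms Φ k, L x = 0 → x = 0) (G : Matrix m m ℤ)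
    (hG : ∀ i j, (G i j : ℂ) = poincarePairing Φ e h (b i : E [⋀^Fin k]→L[ℝ] ℂ) (L (b j))) :
    Nat.card ((m → ℤ) ⧸ LinearMap.range (Matrix.mulVecLin G)) = G.det.natAbs := by
  obtain ⟨f⟩ := nonempty_addEquiv_quotient_range_mulVecLin_of_eq_poincarePairing Φ e h b L hL G hG
  rw [Nat.card_congr f.toEquiv, ← relIndex_map_integralForms_eq_natAbs_det Φ e h b L hL hinj G hG, AddSubgroup.relIndex, AddSubgroup.index]

end Glue

/-! ## §2 The `H¹` Lefschetz form of the minimal class: `ℤ^{2g}/G₁·ℤ^{2g} ≅ ⊕_x ℤ/(d_g/d_{a(x)})` -/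

section DegreeOne

variable {ι : Type*} [Fintype ι] [DecidableEq ι] {E : Type*} [NormedAddCommGroup E] [NormedSpace ℂ E]
  {Φ : (ι → ℝ) ≃L[ℝ] E} {j n : ℕ} {η : E [⋀^Fin 2]→L[ℝ] ℝ} {d : Fin (j + 2) → ℕ}

/-- **The discriminant group of the `H¹` Lefschetz form.** For a polarised complex torus of type `(d₁, …, d_g)` (`g = j + 2`; any presentation
`Φ`, any orientation `e`), the minimal class `m = γ_{g−1}` (`θ^{∧(g−1)} = ((g−1)!·d₁⋯d_{g−1})·m`), ANY `ℤ`-basis `b` of `H¹(X, ℤ)` and the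
integer Gram matrix `G = (⟨b_i, m ∧ b_{i'}⟩)` of `B₁(x, y) = ⟨x, γ_{g−1} ∧ y⟩`:

  `ℤ^{2g}/G·ℤ^{2g} ≃+ ⊕_x ℤ/(d_g/d_{a(x)}) = ⊕_{a=1}^{g} (ℤ/(d_g/d_a))²`

(the letters `x ∈ Fin g ⊕ Fin g`, `a(x)` the index of `x`) — the elementary divisors of `G` are the `d_g/d_a`, each twice; `|det G| = ∏ (d_g/d_a)²`
(g41-#1). [cite: Lange2023AbelianVarietiesComplex, §6.2.4 (PDF p. 310); §5.4.1 Thm. 5.4.1 and (5.22) (PDF p. 275); §2.5.3 Cor. 2.5.17 (c) (PDF p. 135); §1.5.1 (PDF p. 51)] [cite: ConwaySloane1999, Ch. 2 §2.4 (PDF p. 162)] [cite: VoisinHodgeI2002, §7.2.2 (PDF p. 142 L10)] -/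
theorem IsPolarizationType.nonempty_addEquiv_quotient_range_mulVecLin_pi_zmod_of_eq_content_smul (hd : IsPolarizationType Φ η d)
    (hη : IsRiemannForm Φ η) (hle₁ : j + 1 ≤ j + 2) {m : E [⋀^Fin (2 * (j + 1))]→L[ℝ] ℂ}
    (hm : wedgePow (ofRealForm η) (j + 1) = (((j + 1).factorial * ∏ i : Fin (j + 1), d (Fin.castLE hle₁ i) : ℕ) : ℂ) • m)
    (e : Fin n ≃ ι) (hn : 1 + (2 * j + 3) = n) {μ : Type*} [Fintype μ] [DecidableEq μ] (b : Basis μ ℤ ↥(integralForms Φ 1))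
    (G : Matrix μ μ ℤ) (hG : ∀ i i', (G i i' : ℂ) =
      poincarePairing Φ e hn (b i : E [⋀^Fin 1]→L[ℝ] ℂ) (m.wedge (b i' : E [⋀^Fin 1]→L[ℝ] ℂ) : E [⋀^Fin (2 * j + 3)]→L[ℝ] ℂ)) :
    Nonempty (((μ → ℤ) ⧸ LinearMap.range (Matrix.mulVecLin G)) ≃+
      ((x : Fin (j + 2) ⊕ Fin (j + 2)) → ZMod (d (Fin.last (j + 1)) / d (Sum.elim id id x)))) := by
  obtain ⟨Φ', hΛ, hs⟩ := hd.exists_isSymplecticEnum Φ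
  have hmZ : m ∈ integralForms Φ (2 * (j + 1)) := by
    rw [← integralForms_eq_of_range_latticeVec_eq hΛ (2 * (j + 1))]
    exact hs.mem_integralForms_of_wedgePow_eq_content_smul Φ' (hη.of_range_latticeVec_subset hΛ.le) hle₁ hm
  have hL : (integralForms Φ 1).map (AddMonoidHom.mk' (fun x : E [⋀^Fin 1]→L[ℝ] ℂ ↦ (m.wedge x : E [⋀^Fin (2 * j + 3)]→L[ℝ] ℂ))
      (ContinuousAlternatingMap.wedge_add_right _)) ≤ integralForms Φ (2 * j + 3) := by
    rintro _ ⟨x, hx, rfl⟩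
    exact wedge_mem_integralForms Φ hmZ hx
  obtain ⟨f⟩ := nonempty_addEquiv_quotient_range_mulVecLin_of_eq_poincarePairing Φ e hn b _ hL G hG
  obtain ⟨g⟩ := hd.nonempty_addEquiv_quotient_map_wedge_integralForms_one_of_eq_content_smul hη hle₁ hm
  exact ⟨f.trans g⟩

/-- **Existence form**: every polarised complex torus of type `(d₁, …, d_g)` (`g = j + 2`) carries the integral minimal class `γ_{g−1}`, and for every
`ℤ`-basis `b` of `H¹(X, ℤ)` the Gram matrix of `⟨·, γ_{g−1} ∧ ·⟩` is an integer matrix `G` with `ℤ^{2g}/G·ℤ^{2g} ≃+ ⊕_x ℤ/(d_g/d_{a(x)})`.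
[cite: Lange2023AbelianVarietiesComplex, §6.2.4 (PDF p. 310); §2.5.3 Thm. 2.5.16 and Cor. 2.5.17 (c) (PDF p. 135); §5.4.1 (5.22) (PDF p. 275)] [cite: ConwaySloane1999, Ch. 2 §2.4 (PDF p. 162)] [cite: BenoistDebarre2023SmoothSubvarietiesJacobians, §1 (p. 3)] -/
theorem IsPolarizationType.exists_minimalClass_nonempty_addEquiv_quotient_range_mulVecLin_pi_zmod (hd : IsPolarizationType Φ η d)
    (hη : IsRiemannForm Φ η) (hle₁ : j + 1 ≤ j + 2) (e : Fin n ≃ ι) (hn : 1 + (2 * j + 3) = n) {μ : Type*} [Fintype μ] [DecidableEq μ]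
    (b : Basis μ ℤ ↥(integralForms Φ 1)) :
    ∃ m ∈ integralForms Φ (2 * (j + 1)),
      wedgePow (ofRealForm η) (j + 1) = (((j + 1).factorial * ∏ i : Fin (j + 1), d (Fin.castLE hle₁ i) : ℕ) : ℂ) • m ∧
      ∃ G : Matrix μ μ ℤ, (∀ i i', (G i i' : ℂ) =
          poincarePairing Φ e hn (b i : E [⋀^Fin 1]→L[ℝ] ℂ) (m.wedge (b i' : E [⋀^Fin 1]→L[ℝ] ℂ) : E [⋀^Fin (2 * j + 3)]→L[ℝ] ℂ)) ∧
        Nonempty (((μ → ℤ) ⧸ LinearMap.range (Matrix.mulVecLin G)) ≃+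
          ((x : Fin (j + 2) ⊕ Fin (j + 2)) → ZMod (d (Fin.last (j + 1)) / d (Sum.elim id id x)))) := by
  obtain ⟨m, hmZ, hm⟩ := hd.exists_mem_integralForms_wedgePow_eq_content_smul hle₁
  have hL : (integralForms Φ 1).map (AddMonoidHom.mk' (fun x : E [⋀^Fin 1]→L[ℝ] ℂ ↦ (m.wedge x : E [⋀^Fin (2 * j + 3)]→L[ℝ] ℂ))
      (ContinuousAlternatingMap.wedge_add_right _)) ≤ integralForms Φ (2 * j + 3) := by
    rintro _ ⟨x, hx, rfl⟩
    exact wedge_mem_integralForms Φ hmZ hx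
  obtain ⟨G, hG⟩ := exists_matrix_eq_poincarePairing_map Φ e hn b _ hL
  exact ⟨m, hmZ, hm, G, hG, hd.nonempty_addEquiv_quotient_range_mulVecLin_pi_zmod_of_eq_content_smul hη hle₁ hm e hn b G hG⟩

end DegreeOne

/-! ## §3 The `H²` Lefschetz form of the minimal class, constant type: `ℤ^m/G₂·ℤ^m ≅ ℤ/(g−1)` -/

section DegreeTwo

variable {ι : Type*} [Fintype ι] [DecidableEq ι] {E : Type*} [NormedAddCommGroup E] [NormedSpace ℂ E]
  {Φ : (ι → ℝ) ≃L[ℝ] E} {j n : ℕ} {η : E [⋀^Fin 2]→L[ℝ] ℝ} {d : Fin (j + 2) → ℕ}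

/-- **The discriminant group of the `H²` Lefschetz form for a constant type is `ℤ/(g−1)`.** For a polarised complex torus of constant type
`(k, …, k)` (e.g. a principal polarisation; `g = j + 2`; any presentation, any orientation), the minimal class `γ = γ_{g−2}`
(`θ^{∧(g−2)} = ((g−2)!·k^{g−2})·γ`), ANY `ℤ`-basis `b` of `H²(X, ℤ)` and the (symmetric, even) integer Gram matrix `G = (⟨b_i, γ ∧ b_{i'}⟩)` of
`B₂(x, y) = ⟨x, γ_{g−2} ∧ y⟩`: `ℤ^m/G·ℤ^m ≃+ ℤ/(g−1)` — a single non-trivial elementary divisor `g − 1` (`|det G| = g − 1`, g41-#1).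
[cite: Lange2023AbelianVarietiesComplex, §6.2.4 (PDF p. 310); §4.2 (PDF p. 204); §2.5.3 Cor. 2.5.17 (PDF p. 135); §5.4.1 Thm. 5.4.1 and (5.22) (PDF p. 275); §2.1.1] [cite: ConwaySloane1999, Ch. 2 §2.4 (PDF p. 162)] [cite: VoisinHodgeI2002, §7.1.2 (PDF p. 134 L31)] [cite: BenoistDebarre2023SmoothSubvarietiesJacobians, §1 (p. 3)] -/
theorem IsPolarizationType.nonempty_addEquiv_quotient_range_mulVecLin_zmod_of_eq_content_smul_of_forall_eq (hd : IsPolarizationType Φ η d)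
    (hη : IsRiemannForm Φ η) (hle : j ≤ j + 2) {γ : E [⋀^Fin (2 * j)]→L[ℝ] ℂ}
    (hγ : wedgePow (ofRealForm η) j = ((j.factorial * ∏ i : Fin j, d (Fin.castLE hle i) : ℕ) : ℂ) • γ) (hd₀ : ∀ i, d i = d 0)
    (e : Fin n ≃ ι) (hn : 2 + (2 * j + 2) = n) {μ : Type*} [Fintype μ] [DecidableEq μ] (b : Basis μ ℤ ↥(integralForms Φ 2))
    (G : Matrix μ μ ℤ) (hG : ∀ i i', (G i i' : ℂ) = poincarePairing Φ e hn (b i : E [⋀^Fin 2]→L[ℝ] ℂ) (γ.wedge (b i' : E [⋀^Fin 2]→L[ℝ] ℂ))) :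
    Nonempty (((μ → ℤ) ⧸ LinearMap.range (Matrix.mulVecLin G)) ≃+ ZMod (j + 1)) := by
  obtain ⟨Φ', hΛ, hs⟩ := hd.exists_isSymplecticEnum Φ
  have hL : (integralForms Φ 2).map (AddMonoidHom.mk' (fun x : E [⋀^Fin 2]→L[ℝ] ℂ ↦ γ.wedge x)
      (ContinuousAlternatingMap.wedge_add_right _)) ≤ integralForms Φ (2 * j + 2) := by
    rw [← integralForms_eq_of_range_latticeVec_eq hΛ 2, ← integralForms_eq_of_range_latticeVec_eq hΛ (2 * j + 2)]
    exact hs.map_wedge_integralForms_two_le_of_eq_content_smul Φ' (hη.of_range_latticeVec_subset hΛ.le) hle hγ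
  obtain ⟨f⟩ := nonempty_addEquiv_quotient_range_mulVecLin_of_eq_poincarePairing Φ e hn b _ hL G hG
  obtain ⟨g⟩ := hd.nonempty_addEquiv_quotient_map_wedge_integralForms_two_zmod_of_eq_content_smul hη hle hγ hd₀
  exact ⟨f.trans g⟩

/-- **Existence form, constant type**: the integral minimal class `γ_{g−2}` exists and, on every `ℤ`-basis of `H²(X, ℤ)`, the Gram matrix `G` of
`⟨·, γ_{g−2} ∧ ·⟩` is an integer matrix with `ℤ^m/G·ℤ^m ≃+ ℤ/(g−1)` (`g = j + 2`).
[cite: Lange2023AbelianVarietiesComplex, §6.2.4 (PDF p. 310); §4.2 (PDF p. 204); §2.5.3 Thm. 2.5.16 and Cor. 2.5.17 (PDF p. 135); §5.4.1 (5.22) (PDF p. 275)] [cite: ConwaySloane1999, Ch. 2 §2.4 (PDF p. 162)] [cite: BenoistDebarre2023SmoothSubvarietiesJacobians, §1 (p. 3)] -/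
theorem IsPolarizationType.exists_minimalClass_nonempty_addEquiv_quotient_range_mulVecLin_zmod_of_forall_eq (hd : IsPolarizationType Φ η d)
    (hη : IsRiemannForm Φ η) (hle : j ≤ j + 2) (hd₀ : ∀ i, d i = d 0) (e : Fin n ≃ ι) (hn : 2 + (2 * j + 2) = n) {μ : Type*} [Fintype μ]
    [DecidableEq μ] (b : Basis μ ℤ ↥(integralForms Φ 2)) :
    ∃ γ ∈ integralForms Φ (2 * j), wedgePow (ofRealForm η) j = ((j.factorial * ∏ i : Fin j, d (Fin.castLE hle i) : ℕ) : ℂ) • γ ∧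
      ∃ G : Matrix μ μ ℤ, (∀ i i', (G i i' : ℂ) = poincarePairing Φ e hn (b i : E [⋀^Fin 2]→L[ℝ] ℂ) (γ.wedge (b i' : E [⋀^Fin 2]→L[ℝ] ℂ))) ∧
        Nonempty (((μ → ℤ) ⧸ LinearMap.range (Matrix.mulVecLin G)) ≃+ ZMod (j + 1)) := by
  obtain ⟨γ, hγZ, hγ⟩ := hd.exists_mem_integralForms_wedgePow_eq_content_smul hle
  have hL : (integralForms Φ 2).map (AddMonoidHom.mk' (fun x : E [⋀^Fin 2]→L[ℝ] ℂ ↦ γ.wedge x)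
      (ContinuousAlternatingMap.wedge_add_right _)) ≤ integralForms Φ (2 * j + 2) := by
    rintro _ ⟨x, hx, rfl⟩
    exact wedge_mem_integralForms Φ hγZ hx
  obtain ⟨G, hG⟩ := exists_matrix_eq_poincarePairing_map Φ e hn b _ hL
  exact ⟨γ, hγZ, hγ, G, hG, hd.nonempty_addEquiv_quotient_range_mulVecLin_zmod_of_eq_content_smul_of_forall_eq hη hle hγ hd₀ e hn b G hG⟩

end DegreeTwo

end Literature.Geometry.Kaehler.ComplexTorus
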